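import Mathlib
import Literature.Analysis.FluidPDE.LoopCirculation
import Summits.NavierStokesRegularity.NavierStokesRegularity.Theorems.TautLoopKelvinTautLoopLawLevelLeftContinuityTools2
import HarnessLib

/-!
# Route `TautLoopKelvin`, crux `TautLoopLaw` (stmt-NavierStokesRegularity-15249), line
  `Sketch-ideas-r1k1` (Dini–Saks architecture) — tools stub `stub_tautLoopStepLassoQuantTools`

**The quantitative lasso gain.** Let `v : ℝ³ → ℝ³` be `C²` with a globally `Lc`-Lipschitz curl,
`γ` a closed `C¹` loop, and `x` a point within distance `d` of `γ s` with `‖curl v x‖ ≥ w > 0`.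
For every length budget `τ > 0` there is a closed `C¹` loop `Λ` (a lasso: `γ`, a there-and-back
tether from `γ s` to a small circle about `x`, once around the circle) with

  `|∮_Λ v| ≥ |∮_γ v| + w · min(w/Lc, τ)² / 100`,  `len Λ ≤ len γ + π d + τ`.

This is the quantitative re-run of `tautLoopLlc_lasso_gain`
(`…LevelLeftContinuityTools2`), with the modulus of continuity of `curl v` replaced by the
Lipschitz bound. Mechanism: an orthonormal coordinate frame `(e₁, e₂)` with
`⟪curl v x, e₁ × e₂⟫ ≥ ‖curl v x‖/2 ≥ w/2` (`tautLoopLassoQ_frame`); the circle of radius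
`r := min(w/Lc, τ)/(3π)` about `x` in the plane of the frame; on the disc
`⟪curl v y, e₁ × e₂⟫ ≥ w/2 - Lc r ≥ w/2 - w/(3π)`, so by Stokes on the disc
(`circulation_circleLoop_eq_integral_curl`, packaged as `tautLoopLassoQ_circle_gain`) the circle
gains `π r² (w/2 - Lc r) ≥ w · min(w/Lc, τ)² · (3π - 2)/(54π²) ≥ w · min(w/Lc, τ)²/100`
(`3 < π ≤ 4`); the circle is oriented by the sign of `∮_γ v`
(`tautLoopLlc_circulation_circle_neg`), glued to `γ` by `tautLoopLlc_lasso`, and the extra length is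
`π (d + r) + 2π r = π d + min(w/Lc, τ) ≤ π d + τ` (`tautLoopLassoQ_circle_len`). Folklore.
-/

noncomputable section

open Set MeasureTheory Filter Topology Function Real intervalIntegral Metric
  Literature.Analysis.FluidPDE
open scoped InnerProductSpace RealInnerProductSpace

namespace Summit.NavierStokesRegularity.NavierStokesRegularity.Theorems

set_option linter.dupNamespace false

local notation3 "E3" => EuclideanSpace ℝ (Fin 3)

/-! ## Orthonormal coordinate frames adapted to a vector -/

/-- **An orthonormal coordinate frame adapted to a vector.** For every `u ∈ ℝ³` there are
orthogonal unit vectors `e₁`, `e₂` with `e₁ × e₂` a unit vector and `⟪u, e₁ × e₂⟫ ≥ ‖u‖/2`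
(a suitably ordered pair of standard basis vectors; cf. `tautLoopLlc_frame`, which does not record
the orthogonality). [folklore] -/
theorem tautLoopLassoQ_frame (u : E3) :
    ∃ e₁ e₂ : E3, ‖e₁‖ = 1 ∧ ‖e₂‖ = 1 ∧ ⟪e₁, e₂⟫ = 0 ∧ ‖cross e₁ e₂‖ = 1 ∧
      ‖u‖ / 2 ≤ ⟪u, cross e₁ e₂⟫ := by
  obtain ⟨hc0, hc1, hc2⟩ := tautLoopLlc_cross_single
  have hfr : ∀ i : Fin 3, ∃ e₁ e₂ : E3, ‖e₁‖ = 1 ∧ ‖e₂‖ = 1 ∧ ⟪e₁, e₂⟫ = 0 ∧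
      cross e₁ e₂ = EuclideanSpace.single i 1 := by
    intro i
    fin_cases i
    · exact ⟨_, _, by simp, by simp, by simp [EuclideanSpace.inner_single_left], hc1⟩
    · exact ⟨_, _, by simp, by simp, by simp [EuclideanSpace.inner_single_left], hc2⟩
    · exact ⟨_, _, by simp, by simp, by simp [EuclideanSpace.inner_single_left], hc0⟩
  obtain ⟨i, hi⟩ := tautLoopLlc_exists_coord u
  obtain ⟨e₁, e₂, h1, h2, h12, hx⟩ := hfr i
  have hswap : cross e₂ e₁ = -cross e₁ e₂ := by
    simp only [cross]
    rw [← cross_anticomm, WithLp.toLp_neg]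
  have hn : ‖EuclideanSpace.single i (1:ℝ)‖ = 1 := by simp
  have hinner : ⟪u, EuclideanSpace.single i (1:ℝ)⟫ = u i := by
    simp [EuclideanSpace.inner_single_right]
  rcases le_or_gt 0 (u i) with hpos | hneg
  · refine ⟨e₁, e₂, h1, h2, h12, by rw [hx, hn], ?_⟩
    rw [hx, hinner]
    rwa [abs_of_nonneg hpos] at hi
  · refine ⟨e₂, e₁, h2, h1, by rw [real_inner_comm, h12], by rw [hswap, hx, norm_neg, hn], ?_⟩
    rw [hswap, hx, inner_neg_right, hinner]
    rwa [abs_of_neg hneg] at hi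

/-- Pythagoras in the plane of an orthonormal pair: `‖a e₁ + b e₂‖² = a² + b²`. [folklore] -/
theorem tautLoopLassoQ_norm_comb_sq {e₁ e₂ : E3} (h1 : ‖e₁‖ = 1) (h2 : ‖e₂‖ = 1)
    (h12 : ⟪e₁, e₂⟫ = 0) (a b : ℝ) : ‖a • e₁ + b • e₂‖ ^ 2 = a ^ 2 + b ^ 2 := by
  rw [norm_add_sq_real, norm_smul, norm_smul, h1, h2, real_inner_smul_left,
    real_inner_smul_right, h12]
  simp [Real.norm_eq_abs, sq_abs]

/-- The position and velocity vectors of the unit-speed polar frame of an orthonormal pair have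
norm `|ρ|`: `‖(ρ cos θ) e₁ + (ρ sin θ) e₂‖ = ‖-(ρ sin θ) e₁ + (ρ cos θ) e₂‖ = |ρ|`. [folklore] -/
theorem tautLoopLassoQ_norm_polar {e₁ e₂ : E3} (h1 : ‖e₁‖ = 1) (h2 : ‖e₂‖ = 1)
    (h12 : ⟪e₁, e₂⟫ = 0) (ρ θ : ℝ) :
    ‖(ρ * Real.cos θ) • e₁ + (ρ * Real.sin θ) • e₂‖ = |ρ| ∧
      ‖(-(ρ * Real.sin θ)) • e₁ + (ρ * Real.cos θ) • e₂‖ = |ρ| := by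
  constructor
  · rw [← Real.sqrt_sq (norm_nonneg _), tautLoopLassoQ_norm_comb_sq h1 h2 h12,
      ← Real.sqrt_sq_eq_abs]
    congr 1
    rw [mul_pow, mul_pow, ← mul_add, Real.cos_sq_add_sin_sq, mul_one]
  · rw [← Real.sqrt_sq (norm_nonneg _), tautLoopLassoQ_norm_comb_sq h1 h2 h12,
      ← Real.sqrt_sq_eq_abs]
    congr 1
    rw [neg_sq, mul_pow, mul_pow, ← mul_add, Real.sin_sq_add_cos_sq, mul_one]

/-! ## Planar circles on an orthonormal frame: exact length and the gain of a disc -/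

/-- A planar circle of radius `r` on an orthonormal frame has length exactly `2π|r|`. [folklore] -/
theorem tautLoopLassoQ_circle_len {e₁ e₂ : E3} (h1 : ‖e₁‖ = 1) (h2 : ‖e₂‖ = 1)
    (h12 : ⟪e₁, e₂⟫ = 0) (c : E3) (r : ℝ) :
    ∫ s in (0:ℝ)..1, ‖deriv (circleLoop c r e₁ e₂) s‖ = 2 * π * |r| := by
  have hb : ∀ s, ‖deriv (circleLoop c r e₁ e₂) s‖ = 2 * π * |r| := fun s => by
    rw [deriv_circleLoop, norm_smul, Real.norm_eq_abs,
      abs_of_pos (by positivity : (0:ℝ) < 2 * π), (tautLoopLassoQ_norm_polar h1 h2 h12 _ _).2]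
  simp_rw [hb]
  rw [intervalIntegral.integral_const, sub_zero, smul_eq_mul, one_mul]

/-- **Gain of a disc.** If `⟪curl v, e₁ × e₂⟫ ≥ w` on the closed ball of radius `r ≥ 0` about
`c` (`e₁`, `e₂` orthogonal unit vectors), the circulation of the `C¹` field `v` around
`circleLoop c r e₁ e₂` is at least `π r² w` (Stokes on the disc,
`circulation_circleLoop_eq_integral_curl`; cf. `tautLoopLlc_circle_gain`, which asks for the bound
on the ball of radius `2r`). [folklore] -/
theorem tautLoopLassoQ_circle_gain {v : E3 → E3} (hv : ContDiff ℝ 1 v) {c e₁ e₂ : E3}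
    (h1 : ‖e₁‖ = 1) (h2 : ‖e₂‖ = 1) (h12 : ⟪e₁, e₂⟫ = 0) {r w : ℝ} (hr : 0 ≤ r)
    (hw : ∀ y, dist y c ≤ r → w ≤ ⟪curl v y, cross e₁ e₂⟫) :
    π * r ^ 2 * w ≤ circulation v (circleLoop c r e₁ e₂) := by
  rw [circulation_circleLoop_eq_integral_curl hv]
  set f : ℝ → ℝ → ℝ := fun ρ θ =>
    ρ * ⟪curl v (c + (ρ * Real.cos θ) • e₁ + (ρ * Real.sin θ) • e₂), cross e₁ e₂⟫ with hf
  have hcont : Continuous (Function.uncurry f) := by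
    have hc := continuous_curl hv
    have hP : Continuous fun q : ℝ × ℝ =>
        c + (q.1 * Real.cos q.2) • e₁ + (q.1 * Real.sin q.2) • e₂ := by fun_prop
    exact continuous_fst.mul ((hc.comp hP).inner continuous_const)
  have hpt : ∀ ρ ∈ Icc 0 r, ∀ θ, ρ * w ≤ f ρ θ := by
    intro ρ hρ θ
    refine mul_le_mul_of_nonneg_left (hw _ ?_) hρ.1
    rw [dist_eq_norm, show c + (ρ * Real.cos θ) • e₁ + (ρ * Real.sin θ) • e₂ - c =
      (ρ * Real.cos θ) • e₁ + (ρ * Real.sin θ) • e₂ by abel,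
      (tautLoopLassoQ_norm_polar h1 h2 h12 ρ θ).1, abs_of_nonneg hρ.1]
    exact hρ.2
  have hinner : ∀ ρ ∈ Icc 0 r, 2 * π * (ρ * w) ≤ ∫ θ in (0:ℝ)..2 * π, f ρ θ := by
    intro ρ hρ
    have h2π : (0:ℝ) ≤ 2 * π := by positivity
    calc 2 * π * (ρ * w) = ∫ _ in (0:ℝ)..2 * π, ρ * w := by
          rw [intervalIntegral.integral_const, sub_zero, smul_eq_mul]
      _ ≤ ∫ θ in (0:ℝ)..2 * π, f ρ θ :=
          intervalIntegral.integral_mono_on h2π intervalIntegrable_const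
            ((hcont.comp (continuous_const.prodMk continuous_id)).intervalIntegrable _ _)
            (fun θ _ => hpt ρ hρ θ)
  calc π * r ^ 2 * w = ∫ ρ in (0:ℝ)..r, 2 * π * (ρ * w) := by
        rw [show (fun ρ : ℝ => 2 * π * (ρ * w)) = fun ρ : ℝ => ρ * (2 * π * w) by
          funext ρ; ring, intervalIntegral.integral_mul_const, integral_id]
        ring
    _ ≤ ∫ ρ in (0:ℝ)..r, ∫ θ in (0:ℝ)..2 * π, f ρ θ :=
        intervalIntegral.integral_mono_on hr
          ((by fun_prop : Continuous fun ρ : ℝ => 2 * π * (ρ * w)).intervalIntegrable _ _)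
          ((intervalIntegral.continuous_parametric_intervalIntegral_of_continuous' hcont 0
            (2 * π)).intervalIntegrable _ _)
          (fun ρ hρ => hinner ρ hρ)

/-! ## The quantitative lasso gain -/

/-- The numerical heart: with `m := min (w/Lc) τ` and `r := m/(3π)`, the disc gain
`π r² (w/2 - Lc r)` is at least `w m²/100` (using `Lc m ≤ w` and `3 < π ≤ 4`). [folklore] -/
theorem tautLoopLassoQ_gain_arith {w Lc m r : ℝ} (hw : 0 ≤ w) (hmL : Lc * m ≤ w)
    (hr : r = m / (3 * π)) : w * m ^ 2 / 100 ≤ π * r ^ 2 * (w / 2 - Lc * r) := by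
  have hπ3 := Real.pi_gt_three
  have hπ4 := Real.pi_le_four
  have hπ0 : 0 < π := Real.pi_pos
  have hLr : Lc * r ≤ w / (3 * π) := by
    rw [hr, ← mul_div_assoc]
    exact div_le_div_of_nonneg_right hmL (by positivity)
  have hstep : π * r ^ 2 * (w / 2 - w / (3 * π)) ≤ π * r ^ 2 * (w / 2 - Lc * r) :=
    mul_le_mul_of_nonneg_left (by linarith) (by positivity)
  refine le_trans ?_ hstep
  have hid : π * r ^ 2 * (w / 2 - w / (3 * π)) = w * m ^ 2 * ((3 * π - 2) / (54 * π ^ 2)) := by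
    rw [hr]
    field_simp
    ring
  rw [hid, div_eq_mul_one_div (w * m ^ 2) 100]
  refine mul_le_mul_of_nonneg_left ?_ (by positivity)
  rw [div_le_div_iff₀ (by norm_num) (by positivity)]
  nlinarith [mul_nonneg (sub_pos.2 hπ3).le (sub_nonneg.2 hπ4)]

/-- **The quantitative lasso gain.** Let `v` be `C²` with `‖curl v x - curl v y‖ ≤ Lc ‖x - y‖`
globally, `w, τ, Lc > 0`. Every closed `C¹` loop `γ` having a point `x` with `‖curl v x‖ ≥ w`
within distance `d` of `γ s` can be modified into a closed `C¹` loop `Λ` with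
`|∮_Λ v| ≥ |∮_γ v| + w · min(w/Lc, τ)²/100` and `len Λ ≤ len γ + π d + τ` (a lasso through the
circle of radius `min(w/Lc, τ)/(3π)` about `x` in a coordinate plane of large normal vorticity,
oriented by the sign of `∮_γ v`). [folklore] -/
theorem tautLoopLassoQ_lasso_gain {v : E3 → E3} (hv : ContDiff ℝ 2 v) {w τ Lc : ℝ} (hw : 0 < w)
    (hτ : 0 < τ) (hLc : 0 < Lc) (hL : ∀ x y, ‖curl v x - curl v y‖ ≤ Lc * ‖x - y‖)
    {γ : ℝ → E3} (hγ : IsC1Loop γ) {x : E3} {s d : ℝ} (hxs : dist x (γ s) ≤ d)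
    (hwx : w ≤ ‖curl v x‖) :
    ∃ Λ : ℝ → E3, IsC1Loop Λ ∧
      |circulation v γ| + w * (min (w / Lc) τ) ^ 2 / 100 ≤ |circulation v Λ| ∧
      ∫ σ in (0:ℝ)..1, ‖deriv Λ σ‖ ≤ (∫ σ in (0:ℝ)..1, ‖deriv γ σ‖) + π * d + τ := by
  have hv1 : ContDiff ℝ 1 v := hv.of_le one_le_two
  have hvc : Continuous v := hv.continuous
  set m : ℝ := min (w / Lc) τ with hm_def
  have hm0 : 0 < m := lt_min (div_pos hw hLc) hτ
  have hmτ : m ≤ τ := min_le_right _ _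
  have hmL : Lc * m ≤ w := by
    have h : m ≤ w / Lc := min_le_left _ _
    rwa [le_div_iff₀ hLc, mul_comm] at h
  set r : ℝ := m / (3 * π) with hr_def
  have hr0 : 0 < r := by positivity
  have h3r : 3 * π * r = m := by
    rw [hr_def]
    field_simp
  have hkey : w * m ^ 2 / 100 ≤ π * r ^ 2 * (w / 2 - Lc * r) :=
    tautLoopLassoQ_gain_arith hw.le hmL hr_def
  obtain ⟨e₁, e₂, he₁, he₂, he12, hn, hun⟩ := tautLoopLassoQ_frame (curl v x)
  -- `⟪curl v y, e₁ × e₂⟫ ≥ w/2 - Lc r` on the closed ball of radius `r` about `x`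
  have hnear : ∀ y, dist y x ≤ r → w / 2 - Lc * r ≤ ⟪curl v y, cross e₁ e₂⟫ := by
    intro y hy
    have hdist : ‖curl v y - curl v x‖ ≤ Lc * r :=
      (hL y x).trans (by rw [← dist_eq_norm]; exact mul_le_mul_of_nonneg_left hy hLc.le)
    have h1 : ⟪curl v y, cross e₁ e₂⟫ =
        ⟪curl v x, cross e₁ e₂⟫ + ⟪curl v y - curl v x, cross e₁ e₂⟫ := by
      rw [inner_sub_left]; ring
    have h2 : |⟪curl v y - curl v x, cross e₁ e₂⟫| ≤ ‖curl v y - curl v x‖ * ‖cross e₁ e₂‖ :=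
      abs_real_inner_le_norm _ _
    rw [hn, mul_one] at h2
    have h3 := neg_abs_le ⟪curl v y - curl v x, cross e₁ e₂⟫
    linarith
  have hG : π * r ^ 2 * (w / 2 - Lc * r) ≤ circulation v (circleLoop x r e₁ e₂) :=
    tautLoopLassoQ_circle_gain hv1 he₁ he₂ he12 hr0.le hnear
  have hG' : circulation v (circleLoop x r e₁ (-e₂)) ≤ -(π * r ^ 2 * (w / 2 - Lc * r)) := by
    rw [tautLoopLlc_circulation_circle_neg]; linarith
  -- the length budget
  have hqp : ‖x + r • e₁ - γ s‖ ≤ d + r := by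
    calc ‖x + r • e₁ - γ s‖ = ‖(x - γ s) + r • e₁‖ := by congr 1; abel
      _ ≤ ‖x - γ s‖ + ‖r • e₁‖ := norm_add_le _ _
      _ ≤ d + r := by
          rw [norm_smul, he₁, mul_one, Real.norm_eq_abs, abs_of_pos hr0, ← dist_eq_norm]
          linarith
  have he₂' : ‖-e₂‖ = 1 := by rw [norm_neg, he₂]
  have he12' : ⟪e₁, -e₂⟫ = 0 := by rw [inner_neg_right, he12, neg_zero]
  have hcl : ∫ σ in (0:ℝ)..1, ‖deriv (circleLoop x r e₁ e₂) σ‖ = 2 * π * r := by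
    rw [tautLoopLassoQ_circle_len he₁ he₂ he12, abs_of_pos hr0]
  have hcl' : ∫ σ in (0:ℝ)..1, ‖deriv (circleLoop x r e₁ (-e₂)) σ‖ = 2 * π * r := by
    rw [tautLoopLassoQ_circle_len he₁ he₂' he12', abs_of_pos hr0]
  have hbudget : π * (d + r) + 2 * π * r ≤ π * d + τ := by
    have h : π * (d + r) + 2 * π * r = π * d + 3 * π * r := by ring
    rw [h, h3r]
    linarith
  have hπ : π * ‖x + r • e₁ - γ s‖ ≤ π * (d + r) := mul_le_mul_of_nonneg_left hqp Real.pi_pos.le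
  rcases le_or_gt 0 (circulation v γ) with hpos | hneg
  · obtain ⟨Λ, hΛ, hΛc, hΛl⟩ := tautLoopLlc_lasso hvc hγ s x e₁ e₂ r
    refine ⟨Λ, hΛ, ?_, by linarith⟩
    rw [hΛc, abs_of_nonneg hpos, abs_of_nonneg (by nlinarith [sq_nonneg m])]
    linarith
  · obtain ⟨Λ, hΛ, hΛc, hΛl⟩ := tautLoopLlc_lasso hvc hγ s x e₁ (-e₂) r
    refine ⟨Λ, hΛ, ?_, by linarith⟩
    rw [hΛc, abs_of_neg hneg, abs_of_neg (by nlinarith [sq_nonneg m])]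
    linarith

/-- **Tools stub** (registered as `stub_tautLoopStepLassoQuantTools`): the quantitative lasso gain
`w · min(w/Lc, τ)²/100` at length cost `π d + τ`, under a global Lipschitz bound `Lc` on
`curl v`, with all binders explicit. [folklore] -/
theorem stub_tautLoopStepLassoQuantTools : ∀ (v : EuclideanSpace ℝ (Fin 3) → EuclideanSpace ℝ
    (Fin 3)) (d w τ Lc : ℝ), 0 < d → 0 < w → 0 < τ → 0 < Lc → ContDiff ℝ 2 v → (∀ x y,
    ‖Literature.Analysis.FluidPDE.curl v x - Literature.Analysis.FluidPDE.curl v y‖ ≤ Lc * ‖x -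
    y‖) → ∀ γ : ℝ → EuclideanSpace ℝ (Fin 3), Literature.Analysis.FluidPDE.IsC1Loop γ → ∀ (x :
    EuclideanSpace ℝ (Fin 3)) (s : ℝ), dist x (γ s) ≤ d → w ≤
    ‖Literature.Analysis.FluidPDE.curl v x‖ → ∃ Λ : ℝ → EuclideanSpace ℝ (Fin 3),
    Literature.Analysis.FluidPDE.IsC1Loop Λ ∧ |Literature.Analysis.FluidPDE.circulation v γ| + w
    * (min (w / Lc) τ) ^ 2 / 100 ≤ |Literature.Analysis.FluidPDE.circulation v Λ| ∧ (∫ σ in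
    (0:ℝ)..1, ‖deriv Λ σ‖) ≤ (∫ σ in (0:ℝ)..1, ‖deriv γ σ‖) + Real.pi * d + τ :=
  fun _v _d _w _τ _Lc _hd hw hτ hLc hv hL _γ hγ _x _s hxs hwx =>
    tautLoopLassoQ_lasso_gain hv hw hτ hLc hL hγ hxs hwx

end Summit.NavierStokesRegularity.NavierStokesRegularity.Theorems

end
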